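/-
Origin: expansion seat `planner-pub-hodgecm-qw8-g11-0`, handover #28 SPLIT PART 1/3 of tree `HodgeCM/StubTree/Qw8GysinDescent.lean` c37c4c4e (774 l. > 400-line cap) = NEW module `HodgeCM.StubTree.Qw8GysinDescentBase` md5 ec0b134a4aea018c68d2d6b8361541fe (208 l.): verbatim section-boundary slice + docstrings; imports: NO rewrite (tree imports only: HodgeCM.StubTree.Qw8Monomial); check-wip LANDABLE rc 0 / 0 warnings / 0 proof-hole; lean -DautoImplicit=false rc 0; froz (`HOME/pub-hodgecm-qw8-g11/lean/Qw8g11/Qw8GysinDescentBase.lean`, md5 ec0b134a, 208 lines);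
landed by the packager successor (mc-unitary-1-g3, gen-8 kit) in gate run 32 as `HodgeCM/StubTree/Qw8GysinDescentBase.lean` (verbatim).
-/
-- HANDOVER (planner-pub-hodgecm-qw8-g11-0, unit pub-hodgecm-qw8-g11): SPLIT PART 1/3 of the installed
-- `HodgeCM.StubTree.Qw8GysinDescent` (md5 c37c4c4e, 774 l.; 400-line cap, lean/CONVENTIONS.md) = its §§1–3 (ll. 67–228) verbatim +
-- docstrings; WIP module `Qw8g11.Qw8GysinDescentBase`, intended final module `HodgeCM.StubTree.Qw8GysinDescentBase` (NEW file; tree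
-- imports only, NO rewrite). Parts: Qw8GysinDescentBase → Qw8GysinDescentBox → Qw8GysinDescent (import chain).
/-
Copyright (c) 2026. All rights reserved.
Released under Apache 2.0 license as described in the file LICENSE.
-/
import Summits.HodgeConjecture.HodgeCM.StubTree.Qw8Monomial_3

/-!
# F7d `Fact_gysinDescent`, I: the trace-free Gysin fact, base change `ℚ → ℂ`, the top degree of a CM product

Split part 1/3 of `HodgeCM.StubTree.Qw8GysinDescent` (its §§1–3, unchanged; the whole story — why the trace-free form, what
it replaces, the cone over it — is the module docstring of `HodgeCM.StubTree.Qw8GysinDescent`).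

* §1 the fact F7d `Universe.Fact_gysinDescent` ((a) `⊠ ω` with a nonzero top class is injective on `alg`-membership,
  (b) Gysin descent of algebraicity along a block projection) and its derivation `gysinDescent_of_gysin` from F7
  `Fact_gysin` + injectivity of the trace on the top degree (`Fact_trTopCM`, or `Fact_trTop`).
* §2 generic base change `ℚ → ℂ`: `one_tmul_injective`, `baseChange_injective` and descent of submodule membership
  (flatness of `ℂ/ℚ`), `castCoh_baseChange`.
* §3 the top degree `H^{2 dim A′}(A′, ℚ)` of a CM product is a line (`ModelAxioms` + N1 + `Fact_dimProd`).

No statement here is cited; F7d and `Fact_dimProd` enter as explicit hypotheses.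
-/

noncomputable section

open scoped TensorProduct NumberField Classical

namespace HodgeCM

open Literature.AlgebraicGeometry.Motives (CMType)
open HodgeCM.Pohlmann

namespace Universe

variable (U : Universe)

/-! ## 1. The fact F7d and its derivation from F7 + `∫`-injectivity -/

/-- **F7d `Fact_gysinDescent` — injectivity and descent of algebraicity along boxing with a top class.**
For the block projections `p_Y : P = Y × Y' → Y`, `p_{Y'} : P → Y'` of a CM product (`d = dim Y'`) and every nonzero
`ω ∈ H^{2d}(Y', ℚ)`: (a) `p_Y^* e ∪ p_{Y'}^* ω = 0 ⇒ e = 0` (all degrees); (b) `p_Y^* e ∪ p_{Y'}^* ω ∈ Alg^{p+d}(P) ⇒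
e ∈ Alg^p(Y)`.  [Corollary of the projection formula for the Gysin morphism `p_{Y*}` — Voisin, *Hodge Theory and Complex
Algebraic Geometry I* §7.3.2 (PDF p.150–151), Fulton, *Intersection Theory* Ex. 8.1.7 / Prop. 8.3 (c) (PDF p.128,
132–133) — of `H^{2d}(Y', ℚ) ≅ ℚ` by `∫` for connected compact `Y'` — Voisin I Thm 5.30, Rem 5.31 (PDF p.115), proof of
Lemma 7.28 (p.150 L9) — and of `p_{Y*}` preserving algebraic classes — Fulton §19.1, Lemma 19.1.2 (PDF p.356):
`e = (∫ω)⁻¹ p_{Y*}(p_Y^*e ∪ p_{Y'}^*ω)`.  Kernel form of that derivation: `gysinDescent_of_gysin`.] -/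
def Fact_gysinDescent : Prop :=
  ∀ (F : CMField) (n m : ℕ) (Ξ : Fin (n + 1 + (m + 1)) → CMType F)
    (pA : U.Mor (U.cmProd F Ξ) (U.cmProd F (blkA Ξ))) (pB : U.Mor (U.cmProd F Ξ) (U.cmProd F (blkB Ξ))),
    U.IsBlockPair F Ξ pA pB →
    ∀ ω : U.Coh (U.cmProd F (blkB Ξ)) (2 * U.dim (U.cmProd F (blkB Ξ))), ω ≠ 0 →
      (∀ (k : ℕ) (e : U.Coh (U.cmProd F (blkA Ξ)) k),
          U.cup (U.cmProd F Ξ) k _ (U.pull pA k e) (U.pull pB _ ω) = 0 → e = 0) ∧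
      (∀ (p : ℕ) (e : U.Coh (U.cmProd F (blkA Ξ)) (2 * p)),
          U.castCoh (U.cmProd F Ξ) (by omega : 2 * p + 2 * U.dim (U.cmProd F (blkB Ξ)) = 2 * (p + U.dim (U.cmProd F (blkB Ξ))))
              (U.cup (U.cmProd F Ξ) (2 * p) _ (U.pull pA (2 * p) e) (U.pull pB _ ω)) ∈
            U.alg (U.cmProd F Ξ) (p + U.dim (U.cmProd F (blkB Ξ))) →
          e ∈ U.alg (U.cmProd F (blkA Ξ)) p)

variable {U}

/-- two successive degree transports compose to the transport along the composite equality -/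
theorem castCoh_castCoh (X : U.Var) {k l m : ℕ} (h : k = l) (h' : l = m) (x : U.Coh X k) :
    U.castCoh X h' (U.castCoh X h x) = U.castCoh X (h.trans h') x := by subst h; subst h'; rfl

/-- transport along `k = k` is the identity -/
theorem castCoh_self (X : U.Var) {k : ℕ} (h : k = k) (x : U.Coh X k) : U.castCoh X h x = x := rfl

/-- **F7 ∧ (`∫` injective on CM tops) ⇒ F7d**: `e = (∫ω)⁻¹ · p_{Y*}(p_Y^* e ∪ p_{Y'}^* ω)`. -/
theorem gysinDescent_of_gysin (h7 : U.Fact_gysin) (ht : U.Fact_trTopCM) : U.Fact_gysinDescent := by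
  intro F n m Ξ pA pB hP ω hω
  obtain ⟨gy, hgy1, hgy2⟩ := h7 F n m Ξ pA pB hP
  have htr : U.tr _ _ ω ≠ 0 := fun h => hω (ht F m (blkB Ξ) (by rw [h, map_zero]))
  refine ⟨fun k e he => ?_, fun p e he => ?_⟩
  · have h := hgy2 k e ω
    rw [he, map_zero] at h
    rcases smul_eq_zero.mp h.symm with h' | h'
    · exact absurd h' htr
    · exact h'
  · have h1 := hgy1 p _ he
    rw [castCoh_castCoh, castCoh_self, hgy2] at h1
    exact ((U.alg _ p).smul_mem_iff htr).mp h1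

/-- F7d from F7 `Fact_gysin` and `Fact_trTop` (injectivity of the trace on the top degree of every
variety) -/
theorem gysinDescent_of_gysin_trTop (h7 : U.Fact_gysin) (ht : U.Fact_trTop) : U.Fact_gysinDescent :=
  gysinDescent_of_gysin h7 (trTopCM_of_trTop ht)

/-! ## 2. Generic base change `ℚ → ℂ`: injectivity and descent of membership (flatness) -/

section BaseChange

variable {M M' : Type*} [AddCommGroup M] [Module ℚ M] [AddCommGroup M'] [Module ℚ M']

/-- base change `ℚ → ℂ` of an injective linear map is injective (flatness of `ℂ/ℚ`) -/
theorem baseChange_injective {Φ : M →ₗ[ℚ] M'} (h : Function.Injective Φ) :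
    Function.Injective (Φ.baseChange ℂ) := by
  rw [LinearMap.baseChange_eq_ltensor]
  exact Module.Flat.lTensor_preserves_injective_linearMap _ h

/-- the range of `ℂ ⊗ K ↪ ℂ ⊗ M` lies in `K ⊗ ℂ ⊆ M ⊗ ℂ` -/
theorem lTensor_subtype_mem_baseChange (K N : Submodule ℚ M) (hKN : K ≤ N) (z : ℂ ⊗[ℚ] K) :
    LinearMap.lTensor ℂ K.subtype z ∈ N.baseChange ℂ := by
  induction z using TensorProduct.induction_on with
  | zero => simp
  | add a b ha hb => rw [map_add]; exact add_mem ha hb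
  | tmul c k =>
    rw [LinearMap.lTensor_tmul]
    exact Submodule.tmul_mem_baseChange_of_mem c (hKN k.2)

/-- **Flat descent of membership.**  If `Φ ⊗ ℂ` maps `x ∈ M ⊗ ℂ` into `N' ⊗ ℂ` and `Φ⁻¹(N') ⊆ N`, then
`x ∈ N ⊗ ℂ` (exactness of `0 → Φ⁻¹N' → M → M'/N'` is preserved by the flat base change `ℚ → ℂ`). -/
theorem mem_baseChange_of_baseChange_map_mem (Φ : M →ₗ[ℚ] M') (N' : Submodule ℚ M') (N : Submodule ℚ M)
    (hN : ∀ m, Φ m ∈ N' → m ∈ N) {x : ℂ ⊗[ℚ] M} (hx : Φ.baseChange ℂ x ∈ N'.baseChange ℂ) :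
    x ∈ N.baseChange ℂ := by
  -- `g : M → M'/N'`, `gr` its corestriction onto the range, `K = ker g = Φ⁻¹ N'`
  let g : M →ₗ[ℚ] M' ⧸ N' := N'.mkQ ∘ₗ Φ
  let gr : M →ₗ[ℚ] LinearMap.range g := g.rangeRestrict
  have hK : ∀ m, m ∈ LinearMap.ker gr → m ∈ N := by
    intro m hm
    rw [LinearMap.ker_rangeRestrict, LinearMap.mem_ker, LinearMap.comp_apply, Submodule.mkQ_apply,
      Submodule.Quotient.mk_eq_zero] at hm
    exact hN m hm
  -- `(g ⊗ ℂ) x = 0`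
  have hq : ∀ y ∈ N'.baseChange ℂ, (N'.mkQ).baseChange ℂ y = 0 := by
    intro y hy
    rw [Submodule.baseChange_eq_span] at hy
    induction hy using Submodule.span_induction with
    | mem y hy =>
      obtain ⟨c, hc, rfl⟩ := hy
      rw [TensorProduct.mk_apply, LinearMap.baseChange_tmul, Submodule.mkQ_apply,
        (Submodule.Quotient.mk_eq_zero N').mpr hc, TensorProduct.tmul_zero]
    | zero => simp
    | add y z _ _ hy hz => rw [map_add, hy, hz, add_zero]
    | smul a y _ hy => rw [map_smul, hy, smul_zero]
  have hg : g.baseChange ℂ x = 0 := by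
    show (N'.mkQ ∘ₗ Φ).baseChange ℂ x = 0
    rw [LinearMap.baseChange_comp, LinearMap.comp_apply]
    exact hq _ hx
  -- hence `(gr ⊗ ℂ) x = 0` (the inclusion of the range stays injective after the flat base change)
  have hgr : LinearMap.lTensor ℂ gr x = 0 := by
    have hsub : Function.Injective (LinearMap.lTensor ℂ (LinearMap.range g).subtype) :=
      Module.Flat.lTensor_preserves_injective_linearMap _ Subtype.val_injective
    apply hsub
    have hcomp : (LinearMap.range g).subtype ∘ₗ gr = g := LinearMap.ext fun _ => rfl
    rw [map_zero, ← LinearMap.comp_apply, ← LinearMap.lTensor_comp, hcomp, ← LinearMap.baseChange_eq_ltensor]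
    exact hg
  -- exactness of `ker gr ⊗ ℂ → M ⊗ ℂ → range g ⊗ ℂ`
  have hex : Function.Exact (LinearMap.lTensor ℂ (LinearMap.ker gr).subtype) (LinearMap.lTensor ℂ gr) :=
    lTensor_exact ℂ (LinearMap.exact_subtype_ker_map gr) (LinearMap.surjective_rangeRestrict g)
  obtain ⟨z, rfl⟩ := (hex x).mp hgr
  exact lTensor_subtype_mem_baseChange _ N hK z

end BaseChange

/-- `v ↦ 1 ⊗ v : V → ℂ ⊗_ℚ V` is injective (flatness of `ℂ/ℚ`). -/
theorem one_tmul_injective {V : Type*} [AddCommGroup V] [Module ℚ V] :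
    Function.Injective (fun v : V => (1 : ℂ) ⊗ₜ[ℚ] v) := by
  have h := (Module.Flat.rTensor_preserves_injective_linearMap (M := V) (Algebra.linearMap ℚ ℂ)
    (algebraMap ℚ ℂ).injective).comp (TensorProduct.lid ℚ V).symm.injective
  convert h using 1
  ext v
  simp

/-- the base change of the rational degree transport `castCoh` is the complex transport `castC` -/
theorem castCoh_baseChange (X : U.Var) {k l : ℕ} (h : k = l) (y : U.CohC X k) :
    (U.castCoh X h).toLinearMap.baseChange ℂ y = U.castC X h y := by
  induction y using TensorProduct.induction_on with
  | zero => simp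
  | add a b ha hb => rw [map_add, map_add, ha, hb]
  | tmul c x => rw [LinearMap.baseChange_tmul, castC_tmul]; rfl

/-! ## 3. The top degree of a CM product is a line (`ModelAxioms` + N1 + `Fact_dimProd`) -/

/-- **`H^{2 dim A′}(A′, ℚ)` is a line**: there is a nonzero rational top class `ω₀`, and every complex top class is
`c ⊗ ω₀` — from `dim_ℂ H^{K+1}(A′, ℂ) = C(dim H¹, K+1)` (N1) with `K + 1 = 2 dim A′ = dim H¹` (M22 + `Fact_dimProd`). -/
theorem exists_top_generator (M : U.ModelAxioms) (hN1 : U.Fact_cupExterior) (hd : U.Fact_dimProd) (F : CMField)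
    {m : ℕ} (Θ' : Fin (m + 1) → CMType F) :
    ∃ ω₀ : U.Coh (U.cmProd F Θ') (2 * U.dim (U.cmProd F Θ')), ω₀ ≠ 0 ∧
      ∀ ω : U.CohC (U.cmProd F Θ') (2 * U.dim (U.cmProd F Θ')), ∃ c : ℂ, ω = c ⊗ₜ ω₀ := by
  have h2d : 2 * U.dim (U.cmProd F Θ') = (m + 1) * Module.finrank ℚ F :=
    U.two_mul_dim_cmProd_of_dimProd M hd F Θ'
  have hFpos : 0 < Module.finrank ℚ F := Module.finrank_pos
  have hprod : 0 < (m + 1) * Module.finrank ℚ F := Nat.mul_pos (Nat.succ_pos m) hFpos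
  obtain ⟨K, hK⟩ : ∃ K, 2 * U.dim (U.cmProd F Θ') = K + 1 := ⟨2 * U.dim (U.cmProd F Θ') - 1, by omega⟩
  -- `dim_ℂ H^{2d}(A′, ℂ) = 1`
  have hC : Module.finrank ℂ (U.CohC (U.cmProd F Θ') (2 * U.dim (U.cmProd F Θ'))) = 1 := by
    rw [(U.castC (U.cmProd F Θ') hK).finrank_eq, finrank_cohC_succ (hN1 F m Θ' K), finrank_coh_one_cmProd M F Θ',
      ← h2d, hK, Nat.choose_self]
  -- hence `dim_ℚ H^{2d}(A′, ℚ) = 1`: a generator `ω₀`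
  have hQ : Module.finrank ℚ (U.Coh (U.cmProd F Θ') (2 * U.dim (U.cmProd F Θ'))) = 1 := by
    rw [← hC, Module.finrank_baseChange]
  obtain ⟨ω₀, hω₀⟩ : ∃ ω₀ : U.Coh (U.cmProd F Θ') (2 * U.dim (U.cmProd F Θ')), ω₀ ≠ 0 :=
    Module.finrank_pos_iff_exists_ne_zero.mp (by rw [hQ]; exact one_pos)
  have h1 : ((1 : ℂ) ⊗ₜ[ℚ] ω₀ : U.CohC (U.cmProd F Θ') _) ≠ 0 := fun h =>
    hω₀ (one_tmul_injective (h.trans (TensorProduct.tmul_zero _ (1 : ℂ)).symm))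
  refine ⟨ω₀, hω₀, fun ω => ?_⟩
  obtain ⟨c, hc⟩ := (finrank_eq_one_iff_of_nonzero' _ h1).mp hC ω
  exact ⟨c, by rw [← hc, TensorProduct.smul_tmul', smul_eq_mul, mul_one]⟩

end Universe

end HodgeCM

end
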